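import Literature.Computability.Learning.PAC
import Literature.Computability.MetaComplexity.NaturalProofs
import Literature.Computability.Complexity.ConstantDepth
import Mathlib.Analysis.SpecialFunctions.Pow.Real
import HarnessLib

/-!
# Learning algorithms from natural proofs (Carmosino–Impagliazzo–Kabanets–Kolokolova 2016)

Named facts (D-0014) requested by route PneNP/Learning, crux #4 (`wi-03894`), from
Carmosino–Impagliazzo–Kabanets–Kolokolova, *Learning algorithms from natural proofs*, CCC 2016
(= ECCC TR16-008, *Algorithms from natural lower bounds*; theorem numbers below are those of the
ECCC report, whose text was checked): a `P`-natural property with largeness `≥ 1/5` useful against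
`Λ[u]`, for a circuit class `Λ ⊇ AC⁰[p]`, yields a randomised membership-query learner for `Λ`
under the uniform distribution (Thm. 5.1); with the Razborov–Smolensky natural properties this
learns `AC⁰[p]` in quasi-polynomial time (Cor. 5.4 / Thm. 1.2).

Vocabulary added on top of `PAC.lean` / `NaturalProofs.lean`:

* budgets `IsQuasiPolyBudget t` (`t ≤ 2^{(log₂ (N+2))^c}`, `N = n + ⌈1/ε⌉ + ⌈1/δ⌉`) and
  `IsSubexpBudget t` (`∀ γ > 0`, eventually `t ≤ 2^{N^γ}`); the corresponding
  `QuasiPolyPACPredictable`, `SubexpPACPredictable` (as `PolyPACPredictable`: polynomial-time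
  learner and evaluator step functions; coin, round and evaluation budgets of the stated growth);
* `HasDensity q P` — largeness with constant density `1/q` at every length
  (`2^(2^n) ≤ q · |Pₙ|`), the hypothesis "largeness at least `1/5`" of Thm. 5.1;
* `ac0ModClass p d k` — the concept class of `n`-variate functions with an `accBasis p`-circuit
  (`∧, ∨, ¬, MOD_p`, unbounded fan-in) of `acDepth ≤ d` and size `≤ n^k + k`.

## Faithfulness (why the facts are implied by the printed statements)

* CIKK's learners use membership queries only and output a CIRCUIT `ε`-approximating `f` under the
  uniform distribution with constant success probability, in the stated time. We record the
  consequence for the tree's representation-free notion `IsPACPredictorFor uniformDistributions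
  true` (learned string `w` := the circuit, evaluator `E` := circuit evaluation, an oracle-free
  polynomial-time algorithm; random examples are additionally available and
  may be ignored; confidence `1 - δ` by `O(log 1/δ)` repetitions validated with fresh uniform
  membership queries — a `poly(1/ε, log 1/δ)` overhead inside every stated budget class).
* Time in G01 is "polynomial-time step function + number of rounds"; an oracle algorithm of total
  time `T` is simulated with `IsPolyTime` steps and `O(T)` rounds by padding with dummy queries,
  so quasi-polynomial / subexponential TIME becomes `IsPolyTime` + quasi-polynomial /
  subexponential ROUND and COIN budgets.
* Thm. 5.1 is recorded for `Λ =` all Boolean circuits (basis `B₂`, which contains `AC⁰[p]`) and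
  the usefulness regime `u = n^{ω(1)}` (third bullet after Thm. 5.1: time
  `poly(n, 1/ε, 2^{(n s_f/ε)^{o(1)}})`), with `s_f ≤ n^k`: usefulness against every polynomial size
  (`IsUsefulAgainstPPoly`, equivalent to usefulness against one superpolynomial `u`) gives a
  SUBEXPONENTIAL-budget predictor for `sizeClass B2 (n ↦ n^k)`.
* Cor. 5.4 is recorded per depth `d` and size exponent `k` (`s_f ≤ n^k + k`, so
  `quasi-poly(n s_f / ε)` is quasi-polynomial in `n + ⌈1/ε⌉ + ⌈1/δ⌉`).

## References

* M. Carmosino, R. Impagliazzo, V. Kabanets, A. Kolokolova, *Learning algorithms from natural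
  proofs*, CCC 2016, LIPIcs 50, 10:1–10:24; ECCC TR16-008 [CarmosinoImpagliazzoKabanetsKolokolova2016].
* A. Razborov, S. Rudich, *Natural proofs*, JCSS 55 (1997).
-/

noncomputable section

namespace Literature.Computability.Learning

open Complexity Complexity.Classes MetaComplexity Filter _root_.Computability

/-! ### Budgets beyond polynomial -/

/-- A three-argument budget is quasi-polynomially bounded: `t n a b ≤ 2^{(log₂ (n+a+b+2))^c}`.
[CIKK 2016, §5.1 (runtime regimes)] [folklore] -/
def IsQuasiPolyBudget (t : ℕ → ℕ → ℕ → ℕ) : Prop :=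
  ∃ c : ℕ, ∀ n a b, t n a b ≤ 2 ^ (Nat.log 2 (n + a + b + 2)) ^ c

/-- A three-argument budget is subexponential: for every `γ > 0`, `t n a b ≤ 2^{(n+a+b)^γ}` once
`n + a + b` is large. [CIKK 2016, §5.1 (runtime regimes)] [folklore] -/
def IsSubexpBudget (t : ℕ → ℕ → ℕ → ℕ) : Prop :=
  ∀ γ : ℝ, 0 < γ → ∃ N₀ : ℕ, ∀ n a b, N₀ ≤ n + a + b →
    (t n a b : ℝ) ≤ (2 : ℝ) ^ ((n + a + b : ℝ) ^ γ)

/-- A polynomial budget is quasi-polynomial. [folklore] -/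
theorem IsPolyBudget.isQuasiPolyBudget_of_le {t t' : ℕ → ℕ → ℕ → ℕ} (h : IsQuasiPolyBudget t')
    (hle : ∀ n a b, t n a b ≤ t' n a b) : IsQuasiPolyBudget t := by
  obtain ⟨c, hc⟩ := h
  exact ⟨c, fun n a b => (hle n a b).trans (hc n a b)⟩

/-- **Quasi-polynomial predictability** (cf. `PolyPACPredictable`): polynomial-time step function,
quasi-polynomial coin and round budgets. [CIKK 2016, Def. 2.3 with §5.1; Pitt–Warmuth 1990, §2]
[folklore] -/
def QuasiPolyPACPredictable (𝒟 : DistributionFamily) (mq : Bool) (𝒞 : ConceptClass) : Prop :=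
  ∃ (A : OracleAlg (List Bool)) (E : OracleAlg Bool) (coins t t₂ : ℕ → ℕ → ℕ → ℕ),
    A.IsPolyTime (encodingList Bool) ∧ E.IsPolyTime encodingBoolBool ∧
      IsQuasiPolyBudget coins ∧ IsQuasiPolyBudget t ∧ IsQuasiPolyBudget t₂ ∧
        IsPACPredictorFor 𝒟 mq 𝒞 A E coins t t₂

/-- **Subexponential predictability**: polynomial-time step function, subexponential coin and
round budgets. [CIKK 2016, Def. 2.3 with §5.1] [folklore] -/
def SubexpPACPredictable (𝒟 : DistributionFamily) (mq : Bool) (𝒞 : ConceptClass) : Prop :=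
  ∃ (A : OracleAlg (List Bool)) (E : OracleAlg Bool) (coins t t₂ : ℕ → ℕ → ℕ → ℕ),
    A.IsPolyTime (encodingList Bool) ∧ E.IsPolyTime encodingBoolBool ∧
      IsSubexpBudget coins ∧ IsSubexpBudget t ∧ IsSubexpBudget t₂ ∧
        IsPACPredictorFor 𝒟 mq 𝒞 A E coins t t₂

/-! ### Density, the class `AC⁰[p]` of bounded depth and size -/

/-- Largeness with constant density `1/q` at EVERY length: `|Pₙ| ≥ |Fₙ| / q`, i.e.
`2^(2^n) ≤ q · |Pₙ|`. (CIKK's "largeness at least `1/5`" is `HasDensity 5`; RR-largeness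
`2^{-O(n)}` upgrades to density `1/2` by CIKK Lemma 2.7 at the cost of shrinking `n`.)
[CIKK 2016, Def. 2.6, Lemma 2.7] [cite: CarmosinoImpagliazzoKabanetsKolokolova2016, Def. 2.6] -/
def HasDensity (q : ℕ) (P : CombinatorialProperty) : Prop :=
  ∀ n, 2 ^ (2 ^ n) ≤ q * Nat.card (P n)

/-- Constant density implies RR-largeness. [folklore] -/
theorem HasDensity.isLarge {q : ℕ} {P : CombinatorialProperty} (h : HasDensity q P) :
    IsLarge P := by
  refine ⟨q, Filter.eventually_atTop.2 ⟨1, fun n hn => (h n).trans ?_⟩⟩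
  refine Nat.mul_le_mul_right _ ?_
  calc q ≤ 2 ^ q := Nat.lt_two_pow_self.le
    _ ≤ 2 ^ (q * n) := Nat.pow_le_pow_right (by norm_num) (Nat.le_mul_of_pos_right q hn)

/-- The concept class `AC⁰[p]` at depth `d` and size exponent `k`: `n`-variate functions computed
by an unbounded fan-in circuit over `{∧, ∨, ¬, MOD_p}` (`accBasis p`) of `acDepth ≤ d` and at most
`n^k + k` gates. [CIKK 2016, §2.1; Arora–Barak 2009, Def. 14.3] [folklore] -/
def ac0ModClass (p d k : ℕ) : ConceptClass := fun n =>
  {f | ∃ C : Circuit (Fin n), C.IsOver (accBasis p) ∧ C.acDepth ≤ d ∧ C.size ≤ n ^ k + k ∧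
    C.Computes f}

/-- `ac0ModClass` grows with depth and size exponent. [folklore] -/
theorem ac0ModClass_mono {p d d' k k' : ℕ} (hd : d ≤ d') (hk : k ≤ k') (n : ℕ) :
    ac0ModClass p d k n ⊆ ac0ModClass p d' k' n := by
  rintro f ⟨C, hB, hdep, hs, hf⟩
  refine ⟨C, hB, hdep.trans hd, hs.trans ?_, hf⟩
  rcases Nat.eq_zero_or_pos n with rfl | hn
  · rcases k with _ | k <;> rcases k' with _ | k' <;> simp at * ; omega
  · exact Nat.add_le_add (Nat.pow_le_pow_right hn hk) hk

/-! ### Named facts -/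

/-- **CIKK Thm. 5.1, instance `Λ =` all circuits, `u = n^{ω(1)}`** (ECCC TR16-008, Thm. 5.1 with
the third runtime regime listed after it). If some combinatorial property `R` is `P`-constructive,
has density `≥ 1/5` at every length and is useful against `B₂`-circuits of every polynomial size,
then for every `k` the functions with `B₂`-circuits of size `≤ n^k` are learnable with membership
queries under the uniform distribution by a randomised predictor with polynomial-time steps and
SUBEXPONENTIAL (`2^{N^{o(1)}}`, `N = n + ⌈1/ε⌉ + ⌈1/δ⌉`) round and coin budgets. See the module
docstring for the reduction of the printed statement (circuit output, MQ only, constant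
confidence, total time) to this form. [cite: CarmosinoImpagliazzoKabanetsKolokolova2016, Thm. 5.1] -/
def cikk_natural_implies_learning : Prop :=
  ∀ R : CombinatorialProperty, IsConstructive P R → HasDensity 5 R → IsUsefulAgainstPPoly R →
    ∀ k : ℕ, SubexpPACPredictable uniformDistributions true (sizeClass B2 fun n => n ^ k)

/-- **CIKK Cor. 5.4 / Thm. 1.2: `AC⁰[p]` is learnable in quasi-polynomial time** (ECCC TR16-008,
Cor. 5.4, from Thm. 5.1 and the Razborov–Smolensky natural property, Thm. 5.3 there). For every
prime `p`, depth `d` and size exponent `k`, the class `ac0ModClass p d k` is learnable with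
membership queries under the uniform distribution by a randomised predictor with polynomial-time
steps and quasi-polynomial round and coin budgets in `n + ⌈1/ε⌉ + ⌈1/δ⌉`.
[cite: CarmosinoImpagliazzoKabanetsKolokolova2016, Cor. 5.4] -/
def cikk_learn_AC0Mod : Prop :=
  ∀ p : ℕ, p.Prime → ∀ d k : ℕ, QuasiPolyPACPredictable uniformDistributions true (ac0ModClass p d k)

/-- The `AC⁰[p]` learning fact passes to smaller depth/size. [folklore] -/
theorem cikk_learn_AC0Mod.of_le (h : cikk_learn_AC0Mod) {p : ℕ} (hp : p.Prime) {d d' k k' : ℕ}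
    (hd : d ≤ d') (hk : k ≤ k') :
    QuasiPolyPACPredictable uniformDistributions true (ac0ModClass p d k) := by
  obtain ⟨A, E, coins, t, t₂, hA, hE, hc, ht, ht₂, hL⟩ := h p hp d' k'
  exact ⟨A, E, coins, t, t₂, hA, hE, hc, ht, ht₂, fun n f hf => hL n f (ac0ModClass_mono hd hk n hf)⟩

end Literature.Computability.Learning

end
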